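/-
Copyright (c) 2026 the pub-hodgecm-mathlib formalisation cell (harness21).  Track B «K2-LIT» prover seat hodgecm-mathlib-K2E3-p21 (g0), 2026-09-03: (S)-WILD, second rung —
the TYPE-TWO-STAR HOROCYCLE STEP of the `U(3)` lattice tree at a RAMIFIED QUADRATIC DATUM of ANY residue characteristic (the `|2| < 1` twin of ★ R2
`UnitaryLatticeTreeHorocycleTypeTwoStarRamified`, whose element `u(0, z∕ϖ)` needs `σϖ = −ϖ` and `|2| = 1`).  Dealer K2E3-plan (g1) DEALS BATCH #1 ∕ SYNC 22:07:32Z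
(p21 pays «★73-W»); feasibility word K2/STATUS 22:06:26Z: the wild EP-NORM-ONE ∕ CROSS-ZERO tower hinges on the horocycle step (S) at the wild datum.
-/
import Literature.NumberTheory.Automorphic.UnitaryLatticeTreeHorocycleRootStar           -- ★ A-I-1 (LH10-p02 (g14)) p853437: the datum-free one-liners `v_add∕sub∕mul_le_one_of_le`, `mem_sup_span_singleton_of_sub_smul_mem`, `span_singleton_le_of_mem`; brings ★ 39γ `coe_apartmentEnum_zero`, ★ `latticeGraphIso_one_apply`, ★ `mem_unitaryGroupOfForm_iff_of_coe_eq_upperUnipotent`, ★ `upperUnipotent_mulVec`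
import Literature.NumberTheory.Automorphic.UnitaryLatticeTreeTypeTwoStarCountWild          -- ★ p854683 (LH4-p02 (g12)): V3 at the datum `mem_neighborSet_N₁_iff_exists_vec_of_even`, `isVertexLattice_two_N₁_of_uniformizer`; brings ★ p854568 `exists_trace_add_norm_eq_of_ramified` ((TN)), ★ `v_le_sq_of_map_eq_self`
import Literature.NumberTheory.Automorphic.UnitaryThreeFourFrameDefs                     -- ★ p854559 (B-p04): the datum token `IsRamifiedQuadraticDatum σ ϖ d t`
import HarnessLib
/-!
# Horocycle steps of the `U(3)` tree at a RAMIFIED QUADRATIC DATUM (tame or WILD), II: the TYPE-TWO STAR as one horocycle step —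
# `star(A (−1)) = {A (−2)} ⊔ (N ∩ Stab(A (−1))) · A 0` with NO anti-invariant uniformiser and NO `|2| = 1` (Bruhat–Tits 1972 §10, (4.4.4); Tits 1979 §2.7, §2.10; Serre, *Trees* II.1.1; Jacobowitz 1962 §§9–10)

THE SETTING.  `K` a valued field with finite residue field, `σ` an isometric involution (`hσ`, `hvσ`), `ϖ` ANY uniformiser (`hϖ`), `J₀ = antidiag(1,1,1)`, `U = U(σ, J₀)` acting on
the lattice tree by ★ `latticeGraphIso`; `N` the upper unipotent radical (★ `unipotentU`).  The standard apartment is the bi-infinite path `A : ℤ → 𝓥` (HYPOTHESIS-STYLE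
`(A, hA0, hA1)` as in ★ R2): `A (2a) = latt diag(ϖ^a, 1, ϖ^{-a})`, `A (2a+1) = latt diag(ϖ^{a+1}, 1, ϖ^{-a})`.  The RAMIFIED letters are those of Track A's datum
`IsRamifiedQuadraticDatum σ ϖ d t` (★ `UnitaryThreeFourFrameDefs`): `heven` (non-zero `σ`-fixed elements have EVEN valuation), `hd : |ϖ − σϖ| = |ϖ|^d`, `1 ≤ d`, `h2t : |2| = |ϖ|^t`
— NO `σϖ = −ϖ`, NO `|2| = 1`, NO residual hypothesis.
Cell `pub/hodgecm-mathlib` (D-0151), crux H413 = `stmt-HodgeConjecture-24833`, lane `--supports …`; Track B «K2-LIT» engine E3 (K2E3-plan (g1), seat K2E3-p21: the (X0′)∕EP-NORM-ONE tower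
at a wild place), junction Track A LH4 «(D-RAM) FOUR-FRAME» unit U0 (the wild tree).  Topic `NumberTheory/Automorphic`; namespace `Literature.NumberTheory.Automorphic.UnitaryLatticeTree`.
THEOREMS ONLY (no definition, no instance, no notation, no named fact, no `sorry`).  File I = `UnitaryLatticeTreeHorocycleRootStarWild` ((H2) at the datum, this seat).

THE MATHEMATICS (the one point where a dyadic place differs).  By ★ V3 at the datum (p854683 `mem_neighborSet_N₁_iff_exists_vec_of_even`) the star of `N₁` is the whole projective line
`{N₁ + 𝒪 w(a,b)}`, `w(a,b) = (a∕ϖ, 0, b)`, `(a,b) ∈ 𝒪²` primitive; the cases `|a| < 1` (`y = A 0`, `n = 1`) and `|a| = 1 > |b|` (`y = A (−2)`, excluded) are ★ R2's verbatim.  For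
`|a| = |b| = 1`, `c = a∕b`, one needs an upper unipotent `n = u(α, β, γ) ∈ U` (`γ = −σα`, `β + σβ + ασα = 0`) with `α ∈ 𝒪` (so `n` fixes `N₁`) and `β ≡ c∕ϖ (mod 𝒪)` (so `n·𝒪³ =
N₁ + 𝒪w`).  ★ R2 takes `α = 0`, `β = z∕ϖ` with `σz = z` — unitary only because `σϖ = −ϖ` kills `Tr(z∕ϖ)`, and `z ≡ c` is built with `2⁻¹`.  At a general ramified datum put
`β = c∕ϖ + l`, `α = m`: the unitarity equation becomes `l + σl + mσm = −Tr(c∕ϖ)`, and `Tr(c∕ϖ) = T∕P` with `P = ϖσϖ`, `T = cσϖ + σc·ϖ` a `σ`-FIXED element of valuation `≤ |ϖ|`, hence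
`≤ |ϖ|²` by EVENNESS (★ `v_le_sq_of_map_eq_self`) — so `−Tr(c∕ϖ)` is a `σ`-fixed INTEGER, and Track A's trace-plus-norm representability ★ (TN) `exists_trace_add_norm_eq_of_ramified`
(Jacobowitz 1962 §9–§10: every `σ`-fixed integer is `l + σl + mσm` with `l, m ∈ 𝒪`, by a finite descent through the norm residues at a dyadic place) supplies `l, m`.  The lattice
identities are ★ R2's with the extra `α = m` column (`n⁻¹x = (x₀ − m x₁ + (mγ − β) x₂, x₁ − γ x₂, x₂)`, `|mγ − β| ≤ |ϖ|⁻¹`, `β − c∕ϖ = l ∈ 𝒪`).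
HONEST LABEL: count-neutral generic lattice-tree layer; it re-proves the tame ramified case (`t = 0`) and is NEW at dyadic places (`t ≥ 1`); with file I it gives (S) at the datum
(§2: ★ R3's `…_of_involution` ∘ (H2-datum, H3-datum)), the `hH4` input of the horosphere ∕ orbit-data ∕ horocycle layer of the EP tower at a wild place; h413 OPEN; HC_CM is proved only
modulo the 7 printed citations (2 remaining named inputs hLiu418 = `stmt-HodgeConjecture-24832`, h413 = `stmt-HodgeConjecture-24833`) until rung 0 closes; nothing printed is asserted
here — elementary lattice algebra over a valued field.

THIS FILE.
* §1 **(H3-ram)** `exists_mem_unipotentU_apply_apartmentEnum_zero_eq_of_adj_neg_one_of_ramified` (`hσ hvσ hϖ heven hd h1d h2t`, `[Finite 𝓀[K]]`) — conclusion VERBATIM = ★ (H3)'s.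
* §2 **(H3-datum)** `…_of_adj_neg_one_of_isRamifiedQuadraticDatum` (`hD : IsRamifiedQuadraticDatum σ ϖ d t`, U0 currency).

## References
* [BruhatTits1972] F. Bruhat, J. Tits, *Groupes réductifs sur un corps local I*, Publ. Math. IHÉS 41 (1972), §10 (lattice models of the rank-one unitary building), (4.4.4)
  (the stabiliser of a vertex is transitive on the chambers containing it), (7.4.18).
* [Tits1979] J. Tits, *Reductive groups over local fields*, Proc. Sympos. Pure Math. 33.1 (1979), §2.7 (p. 48), §2.10 (p. 49) (rank one: the building is a tree; the ramified `SU₃`,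
  all residue characteristics), §3.5.
* [Serre1980Trees] J.-P. Serre, *Trees* (1980), Ch. II §1.1 (lattices, the apartment of diagonal lattices, the action of unipotent matrices), Ch. I §2.
* [Jacobowitz1962] R. Jacobowitz, *Hermitian forms over local fields*, Amer. J. Math. 84 (1962), §9 Prop. 9.1, §10 Prop. 10.3 (ramified dyadic: norm residues, `nL = 𝒪_F`).
* [Rogawski1990] J. D. Rogawski, *Automorphic Representations of Unitary Groups in Three Variables*, Ann. of Math. Stud. 123 (1990), §1.10 p. 9 (`B = MN`, `N = {u(x, z)}`), §4.5 p. 45.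
-/

set_option autoImplicit false

noncomputable section

open scoped Valued WithZero Matrix MatrixGroups

namespace Literature.NumberTheory.Automorphic.UnitaryLatticeTree

open _root_.SimpleGraph Literature.NumberTheory.Automorphic Literature.NumberTheory.Automorphic.HermitianLattice
open Literature.NumberTheory.Automorphic.CartanUnique (uniformizer_ne_zero uniformizer_mem_integer)
open Literature.NumberTheory.Automorphic.UnitaryGroup
open Literature.NumberTheory.Automorphic.UnitaryThreeFourFrame

variable {K : Type*} [Field K] [Valued K ℤᵐ⁰] {σ : K →+* K} {ϖ : K}

/-- `|p q| ≤ r` for `|p| ≤ 1`, `|q| ≤ r` (local copy of ★ `UnitaryGroup.v_mul_le_of_le_one_of_le`, kept private to spare the import, as in ★ R2). [cite: Serre1980Trees, II.1.1] -/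
private theorem v_mul_le_of_le_one_of_le {p q : K} {r : ℤᵐ⁰} (hp : Valued.v p ≤ 1) (hq : Valued.v q ≤ r) : Valued.v (p * q) ≤ r := by
  rw [map_mul]; exact (mul_le_mul' hp hq).trans_eq (one_mul r)

/-! ## §1 The type-two star as one horocycle step at a ramified datum: `star(A (−1)) = {A (−2)} ⊔ (N ∩ Stab(A (−1))) · A 0` -/

/-- **(H3) AT A RAMIFIED QUADRATIC DATUM (tame or WILD) — THE TYPE-TWO STAR AS ONE HOROCYCLE STEP**: a neighbour `y` of `A (−1) = N₁ = latt diag(1,1,ϖ)` other than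
`A (−2) = latt diag(ϖ⁻¹,1,ϖ)` is `n · A 0` for a unipotent upper-triangular `n ∈ N` fixing `A (−1)`.  Twin of ★ R2 `…_of_adj_neg_one_of_neg` with the tame letters
`(hσϖ : σϖ = −ϖ, hres, h2 : |2| = 1)` replaced by the ramified letters `(heven, hd, h1d, h2t)`; conclusion VERBATIM.  See the module docstring: ★ V3 at the datum; cases `|a| < 1`,
`|a| = 1 > |b|` as ★ R2; for `|a| = |b| = 1` the Heisenberg element `u(m, c∕ϖ + l, −σm)` with `l + σl + mσm = −Tr(c∕ϖ)` from ★ (TN) `exists_trace_add_norm_eq_of_ramified`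
(`−Tr(c∕ϖ) = −T∕P` is a `σ`-fixed integer: `|T| ≤ |ϖ|²` by ★ `v_le_sq_of_map_eq_self`). [cite: BruhatTits1972, (4.4.4) and §10] [cite: Tits1979, §2.7 (p. 48), §2.10 (p. 49)]
[cite: Serre1980Trees, II.1.1] [cite: Jacobowitz1962, §9 Prop. 9.1, §10 Prop. 10.3] [cite: Rogawski1990, §1.10 p. 9] -/
theorem exists_mem_unipotentU_apply_apartmentEnum_zero_eq_of_adj_neg_one_of_ramified [Finite 𝓀[K]]
    (hσ : ∀ x, σ (σ x) = x) (hvσ : ∀ a, Valued.v (σ a) = Valued.v a) (hϖ : Valued.v ϖ = WithZero.exp (-1 : ℤ))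
    (heven : ∀ x : K, σ x = x → x ≠ 0 → ∃ n : ℤ, Valued.v x = WithZero.exp (2 * n)) {d t : ℕ}
    (hd : Valued.v (ϖ - σ ϖ) = Valued.v ϖ ^ d) (h1d : 1 ≤ d) (h2t : Valued.v (2 : K) = Valued.v ϖ ^ t)
    (A : ℤ → {M : Submodule 𝒪[K] (Fin 3 → K) // IsVertex σ ϖ ((StdForm.antidiagonal 3).over K) M})
    (hA0 : ∀ a : ℤ, (A (2 * a)).1 = latt (Matrix.diagonal ![ϖ ^ a, (1 : K), ϖ ^ (-a)]))
    (hA1 : ∀ a : ℤ, (A (2 * a + 1)).1 = latt (Matrix.diagonal ![ϖ ^ (a + 1), (1 : K), ϖ ^ (-a)]))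
    {y : {M : Submodule 𝒪[K] (Fin 3 → K) // IsVertex σ ϖ ((StdForm.antidiagonal 3).over K) M}}
    (hy : (latticeGraph σ ϖ ((StdForm.antidiagonal 3).over K)).Adj (A (-1)) y) (hy' : y ≠ A (-2)) :
    ∃ n : unitaryGroupOfForm σ ((StdForm.antidiagonal 3).over K), n ∈ unipotentU σ ((StdForm.antidiagonal 3).over K) ∧
      latticeGraphIso σ ϖ ((StdForm.antidiagonal 3).over K) n (A (-1)) = A (-1) ∧ latticeGraphIso σ ϖ ((StdForm.antidiagonal 3).over K) n (A 0) = y := by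
  have hϖ0 : ϖ ≠ 0 := uniformizer_ne_zero hϖ
  have hϖ1 : Valued.v ϖ ≤ 1 := v_le_one_of_v_eq_exp_neg_one hϖ
  have hvϖ0 : Valued.v ϖ ≠ 0 := (Valuation.ne_zero_iff _).2 hϖ0
  have hlt1 : ∀ z : K, Valued.v z < 1 ↔ Valued.v z ≤ Valued.v ϖ := fun z => by rw [hϖ]; exact v_lt_one_iff z
  have hA0' : (A 0).1 = stdLattice K 3 := coe_apartmentEnum_zero A hA0
  have hAm1 : (A (-1)).1 = latt (Matrix.diagonal ![(1 : K), 1, ϖ]) := by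
    have h := hA1 (-1)
    rw [show (2 : ℤ) * (-1) + 1 = -1 by norm_num, show (-1 : ℤ) + 1 = 0 by norm_num, neg_neg, zpow_zero, zpow_one] at h
    exact h
  have hAm2 : (A (-2)).1 = latt (Matrix.diagonal ![ϖ⁻¹, (1 : K), ϖ]) := by
    have h := hA0 (-1)
    rw [show (2 : ℤ) * (-1) = -2 by norm_num, neg_neg, zpow_neg, zpow_one] at h
    exact h
  have hd1 : ∀ i, (![(1 : K), 1, ϖ] : Fin 3 → K) i ≠ 0 := by intro i; fin_cases i <;> simp [hϖ0]
  have hstd : ∀ x' : Fin 3 → K, x' ∈ stdLattice K 3 ↔ ∀ i, Valued.v (x' i) ≤ 1 := fun x' => Iff.rfl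
  have hN₁ : ∀ x' : Fin 3 → K, x' ∈ latt (Matrix.diagonal ![(1 : K), 1, ϖ]) ↔ Valued.v (x' 0) ≤ 1 ∧ Valued.v (x' 1) ≤ 1 ∧ Valued.v (x' 2) ≤ Valued.v ϖ := fun x' => by
    rw [mem_latt_diagonal_iff hd1, Fin.forall_fin_succ, Fin.forall_fin_two]
    simp only [Fin.succ_zero_eq_one, Fin.succ_one_eq_two, Matrix.cons_val_zero, Matrix.cons_val_one, Matrix.cons_val_two, Matrix.tail_cons, Matrix.head_cons, map_one]
  -- ★ V3 at the datum (p854683 `…_of_even`): `y = N₁ + 𝒪 w(a,b)`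
  have hroot : A (-1) = ⟨latt (Matrix.diagonal ![(1 : K), 1, ϖ]), 2,
      isVertexLattice_two_N₁_of_uniformizer hvσ hϖ⟩ := Subtype.ext hAm1
  have hw : y ∈ (latticeGraph σ ϖ ((StdForm.antidiagonal 3).over K)).neighborSet ⟨latt (Matrix.diagonal ![(1 : K), 1, ϖ]), 2,
      isVertexLattice_two_N₁_of_uniformizer hvσ hϖ⟩ := by
    rw [SimpleGraph.mem_neighborSet, ← hroot]; exact hy
  obtain ⟨a, b, ha, hb, hprim, hyab⟩ := (mem_neighborSet_N₁_iff_exists_vec_of_even hσ hvσ hϖ heven y).1 hw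
  by_cases hva : Valued.v a < 1
  · -- `|a| < 1`: `y = A 0`, take `n = 1`
    have hvb : Valued.v b = 1 := hprim.resolve_left hva.ne
    have hb0 : b ≠ 0 := fun h => by rw [h, map_zero] at hvb; exact zero_ne_one hvb
    refine ⟨1, Subgroup.one_mem _, latticeGraphIso_one_apply _, ?_⟩
    rw [latticeGraphIso_one_apply]
    apply Subtype.ext
    rw [hA0', hyab]
    apply le_antisymm
    · -- `𝒪³ ≤ N₁ + 𝒪w`: `x = (x − (x₂∕b)·w) + (x₂∕b)·w`
      intro x' hx'
      have hi : ∀ i, Valued.v (x' i) ≤ 1 := hx'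
      refine mem_sup_span_singleton_of_sub_smul_mem (x' 2 / b) (by rw [map_div₀, hvb, div_one]; exact hi 2) ((hN₁ _).2 ⟨?_, ?_, ?_⟩)
      · simp only [Pi.sub_apply, Pi.smul_apply, smul_eq_mul, Matrix.cons_val_zero]
        refine v_sub_le_one_of_le (hi 0) ?_
        rw [map_mul, map_div₀, map_div₀, hvb, div_one]
        calc Valued.v (x' 2) * (Valued.v a / Valued.v ϖ) ≤ 1 * 1 :=
              mul_le_mul' (hi 2) ((div_le_one₀ (zero_lt_iff.2 hvϖ0)).2 ((hlt1 a).1 hva))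
          _ = 1 := one_mul 1
      · simp only [Pi.sub_apply, Pi.smul_apply, smul_eq_mul, Matrix.cons_val_one, Matrix.cons_val_zero, mul_zero, sub_zero]; exact hi 1
      · simp only [Pi.sub_apply, Pi.smul_apply, smul_eq_mul, Matrix.cons_val_two, Matrix.tail_cons, Matrix.head_cons]
        rw [div_mul_cancel₀ _ hb0, sub_self, map_zero]; exact zero_le
    · refine sup_le (fun x' hx' => ?_) (span_singleton_le_of_mem ?_)
      · obtain ⟨h0, h1, h2⟩ := (hN₁ x').1 hx'
        intro i; fin_cases i
        · exact h0
        · exact h1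
        · exact h2.trans hϖ1
      · intro i; fin_cases i
        · change Valued.v (a / ϖ) ≤ 1; rw [map_div₀, div_le_one₀ (zero_lt_iff.2 hvϖ0)]; exact (hlt1 a).1 hva
        · change Valued.v (0 : K) ≤ 1; rw [map_zero]; exact zero_le
        · exact hb
  · have hva1 : Valued.v a = 1 := le_antisymm ha (not_lt.1 hva)
    have ha0 : a ≠ 0 := fun h => by rw [h, map_zero] at hva1; exact zero_ne_one hva1
    by_cases hvb : Valued.v b < 1
    · -- `|a| = 1 > |b|`: `y = A (−2)`, excluded
      exfalso; apply hy'
      apply Subtype.ext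
      rw [hAm2, hyab]
      have hd2 : ∀ i, (![ϖ⁻¹, (1 : K), ϖ] : Fin 3 → K) i ≠ 0 := by intro i; fin_cases i <;> simp [hϖ0]
      have hL : ∀ x' : Fin 3 → K, x' ∈ latt (Matrix.diagonal ![ϖ⁻¹, (1 : K), ϖ]) ↔
          Valued.v (x' 0) ≤ (Valued.v ϖ)⁻¹ ∧ Valued.v (x' 1) ≤ 1 ∧ Valued.v (x' 2) ≤ Valued.v ϖ := fun x' => by
        rw [mem_latt_diagonal_iff hd2, Fin.forall_fin_succ, Fin.forall_fin_two]
        simp only [Fin.succ_zero_eq_one, Fin.succ_one_eq_two, Matrix.cons_val_zero, Matrix.cons_val_one, Matrix.cons_val_two, Matrix.tail_cons, Matrix.head_cons,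
          map_one, map_inv₀]
      have h1inv : (1 : ℤᵐ⁰) ≤ (Valued.v ϖ)⁻¹ := one_le_inv_iff₀.2 ⟨zero_lt_iff.2 hvϖ0, hϖ1⟩
      apply le_antisymm
      · refine sup_le (fun x' hx' => ?_) (span_singleton_le_of_mem ?_)
        · obtain ⟨h0, h1, h2⟩ := (hN₁ x').1 hx'
          exact (hL x').2 ⟨h0.trans h1inv, h1, h2⟩
        · refine (hL _).2 ⟨?_, ?_, ?_⟩
          · simp only [Matrix.cons_val_zero]; rw [map_div₀, hva1, one_div]
          · simp
          · simpa using (hlt1 b).1 hvb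
      · -- `latt diag(ϖ⁻¹,1,ϖ) ≤ N₁ + 𝒪w`: `x = (x − (x₀ϖ∕a)·w) + (x₀ϖ∕a)·w`
        intro x' hx'
        obtain ⟨h0, h1, h2⟩ := (hL x').1 hx'
        have hr : Valued.v (x' 0 * ϖ / a) ≤ 1 := by
          rw [map_div₀, map_mul, hva1, div_one]
          calc Valued.v (x' 0) * Valued.v ϖ ≤ (Valued.v ϖ)⁻¹ * Valued.v ϖ := mul_le_mul_left h0 _
            _ = 1 := inv_mul_cancel₀ hvϖ0
        refine mem_sup_span_singleton_of_sub_smul_mem (x' 0 * ϖ / a) hr ((hN₁ _).2 ⟨?_, ?_, ?_⟩)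
        · simp only [Pi.sub_apply, Pi.smul_apply, smul_eq_mul, Matrix.cons_val_zero]
          rw [show x' 0 - x' 0 * ϖ / a * (a / ϖ) = 0 by field_simp; ring, map_zero]; exact zero_le
        · simp only [Pi.sub_apply, Pi.smul_apply, smul_eq_mul, Matrix.cons_val_one, Matrix.cons_val_zero, mul_zero, sub_zero]; exact h1
        · simp only [Pi.sub_apply, Pi.smul_apply, smul_eq_mul, Matrix.cons_val_two, Matrix.tail_cons, Matrix.head_cons]
          refine (Valuation.map_sub _ _ _).trans (max_le h2 ?_)
          exact v_mul_le_of_le_one_of_le hr ((hlt1 b).1 hvb)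
    · -- `|a| = |b| = 1`: the Heisenberg element `u(m, c∕ϖ + l, −σm)`, `c = a∕b`, with `l + σl + mσm = −Tr(c∕ϖ)` (★ (TN) `exists_trace_add_norm_eq_of_ramified`)
      have hvb1 : Valued.v b = 1 := le_antisymm hb (not_lt.1 hvb)
      have hb0 : b ≠ 0 := fun h => by rw [h, map_zero] at hvb1; exact zero_ne_one hvb1
      have hσϖ0 : σ ϖ ≠ 0 := (map_ne_zero σ).2 hϖ0
      set c : K := a / b with hc
      have hvc : Valued.v c = 1 := by rw [hc, map_div₀, hva1, hvb1, div_one]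
      have h1inv : (1 : ℤᵐ⁰) ≤ (Valued.v ϖ)⁻¹ := one_le_inv_iff₀.2 ⟨zero_lt_iff.2 hvϖ0, hϖ1⟩
      have hvcϖ : Valued.v (c / ϖ) = (Valued.v ϖ)⁻¹ := by rw [map_div₀, hvc, one_div]
      -- the trace numerator `T = c·σϖ + σc·ϖ` is `σ`-fixed of valuation `≤ |ϖ|`, hence `≤ |ϖ|²` (evenness, ★ `v_le_sq_of_map_eq_self`); `P = ϖσϖ`
      set T : K := c * σ ϖ + σ c * ϖ with hT
      have hTσ : σ T = T := by rw [hT, map_add, map_mul, map_mul, hσ, hσ]; ring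
      have hvT1 : Valued.v T ≤ Valued.v ϖ := by
        rw [hT]
        refine (Valuation.map_add _ _ _).trans (max_le ?_ ?_)
        · rw [map_mul, hvc, one_mul, hvσ]
        · rw [map_mul, hvσ, hvc, one_mul]
      have hvT2 : Valued.v T ≤ Valued.v ϖ ^ 2 := v_le_sq_of_map_eq_self hϖ heven hTσ hvT1
      set P : K := ϖ * σ ϖ with hP
      have hPσ : σ P = P := by rw [hP, map_mul, hσ, mul_comm]
      have hP0 : P ≠ 0 := mul_ne_zero hϖ0 hσϖ0
      have hvP : Valued.v P = Valued.v ϖ ^ 2 := by rw [hP, map_mul, hvσ, pow_two]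
      have hvP0 : (0 : ℤᵐ⁰) < Valued.v P := zero_lt_iff.2 ((Valuation.ne_zero_iff _).2 hP0)
      set τ₀ : K := -(T / P) with hτ₀
      have hτσ : σ τ₀ = τ₀ := by rw [hτ₀, map_neg, map_div₀, hTσ, hPσ]
      have hvτ : Valued.v τ₀ ≤ 1 := by
        rw [hτ₀, Valuation.map_neg, map_div₀, div_le_one₀ hvP0, hvP]; exact hvT2
      have htr : c / ϖ + σ (c / ϖ) = T / P := by
        rw [map_div₀, hT, hP]; field_simp
      -- ★ (TN): `l + σ l + m σ m = τ₀` with `l, m ∈ 𝒪`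
      obtain ⟨l, m, hl, hm, hlm⟩ := exists_trace_add_norm_eq_of_ramified hσ hvσ hϖ heven hd h1d h2t hτσ hvτ
      set β : K := c / ϖ + l with hβ
      set γ : K := -σ m with hγ
      have hcσ : γ = -σ m := hγ
      have hrel : β + σ β + m * σ m = 0 := by
        calc β + σ β + m * σ m = (c / ϖ + σ (c / ϖ)) + (l + σ l + m * σ m) := by rw [hβ, map_add]; ring
          _ = T / P + τ₀ := by rw [htr, hlm]
          _ = 0 := by rw [hτ₀]; ring
      have hvγ : Valued.v γ ≤ 1 := by rw [hγ, Valuation.map_neg, hvσ]; exact hm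
      have hvβ : Valued.v β ≤ (Valued.v ϖ)⁻¹ := by
        rw [hβ]; exact (Valuation.map_add _ _ _).trans (max_le hvcϖ.le (hl.trans h1inv))
      have hvmγβ : Valued.v (m * γ - β) ≤ (Valued.v ϖ)⁻¹ :=
        (Valuation.map_sub _ _ _).trans (max_le ((v_mul_le_one_of_le hm hvγ).trans h1inv) hvβ)
      have hβc : β - c / ϖ = l := by rw [hβ]; ring
      -- the element
      let nM : Matrix (Fin 3) (Fin 3) K := !![1, m, β; 0, 1, γ; 0, 0, 1]
      let nMi : Matrix (Fin 3) (Fin 3) K := !![1, -m, m * γ - β; 0, 1, -γ; 0, 0, 1]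
      have hmul : nM * nMi = 1 := by
        ext i j; fin_cases i <;> fin_cases j <;> simp [nM, nMi, Matrix.mul_apply, Fin.sum_univ_three]; ring
      have hmul' : nMi * nM = 1 := by
        ext i j; fin_cases i <;> fin_cases j <;> simp [nM, nMi, Matrix.mul_apply, Fin.sum_univ_three]; ring
      let nG : GL (Fin 3) K := ⟨nM, nMi, hmul, hmul'⟩
      have hnU : nG ∈ unitaryGroupOfForm σ ((StdForm.antidiagonal 3).over K) :=
        (mem_unitaryGroupOfForm_iff_of_coe_eq_upperUnipotent σ hσ (u := nG) rfl).2 ⟨hcσ, hrel⟩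
      -- how `n⁻¹` acts on coordinates
      have hact : ∀ x' : Fin 3 → K, nMi.mulVec x' 0 = x' 0 - m * x' 1 + (m * γ - β) * x' 2 ∧ nMi.mulVec x' 1 = x' 1 - γ * x' 2 ∧ nMi.mulVec x' 2 = x' 2 :=
          fun x' => by
        obtain ⟨e0, e1, e2⟩ := upperUnipotent_mulVec (-m) (m * γ - β) (-γ) x'
        refine ⟨?_, ?_, e2⟩
        · change (!![1, -m, m * γ - β; 0, 1, -γ; 0, 0, 1] : Matrix (Fin 3) (Fin 3) K).mulVec x' 0 = _; rw [e0]; ring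
        · change (!![1, -m, m * γ - β; 0, 1, -γ; 0, 0, 1] : Matrix (Fin 3) (Fin 3) K).mulVec x' 1 = _; rw [e1]; ring
      -- `|(mγ − β) · q| ≤ 1` and `|γ · q| ≤ 1` when `|q| ≤ |ϖ|`
      have hbig : ∀ q : K, Valued.v q ≤ Valued.v ϖ → Valued.v ((m * γ - β) * q) ≤ 1 := fun q hq => by
        rw [map_mul]
        calc Valued.v (m * γ - β) * Valued.v q ≤ (Valued.v ϖ)⁻¹ * Valued.v ϖ := mul_le_mul' hvmγβ hq
          _ = 1 := inv_mul_cancel₀ hvϖ0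
      have hγq : ∀ q : K, Valued.v q ≤ Valued.v ϖ → Valued.v (γ * q) ≤ 1 := fun q hq => v_mul_le_one_of_le hvγ (hq.trans hϖ1)
      -- `x₁` and `x₀` recovered from the coordinates of `n⁻¹ x`
      have hrec1 : ∀ x' : Fin 3 → K, Valued.v (x' 1 - γ * x' 2) ≤ 1 → Valued.v (x' 2) ≤ Valued.v ϖ → Valued.v (x' 1) ≤ 1 := fun x' h1 h2 => by
        rw [show x' 1 = (x' 1 - γ * x' 2) + γ * x' 2 by ring]; exact v_add_le_one_of_le h1 (hγq _ h2)
      have hrec0 : ∀ x' : Fin 3 → K, Valued.v (x' 0 - m * x' 1 + (m * γ - β) * x' 2) ≤ 1 → Valued.v (x' 1) ≤ 1 → Valued.v (x' 2) ≤ Valued.v ϖ →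
          Valued.v (x' 0) ≤ 1 := fun x' h0 h1 h2 => by
        rw [show x' 0 = (x' 0 - m * x' 1 + (m * γ - β) * x' 2) + m * x' 1 - (m * γ - β) * x' 2 by ring]
        exact v_sub_le_one_of_le (v_add_le_one_of_le h0 (v_mul_le_one_of_le hm h1)) (hbig _ h2)
      have hfwd0 : ∀ x' : Fin 3 → K, Valued.v (x' 0) ≤ 1 → Valued.v (x' 1) ≤ 1 → Valued.v (x' 2) ≤ Valued.v ϖ →
          Valued.v (x' 0 - m * x' 1 + (m * γ - β) * x' 2) ≤ 1 := fun x' h0 h1 h2 =>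
        v_add_le_one_of_le (v_sub_le_one_of_le h0 (v_mul_le_one_of_le hm h1)) (hbig _ h2)
      refine ⟨⟨nG, hnU⟩, ?_, ?_, ?_⟩
      · rw [mem_unipotentU_iff]
        refine ⟨?_, fun i => ?_⟩
        · intro i j hij
          change (j : Fin 3) < i at hij
          change nM i j = 0
          fin_cases i <;> fin_cases j <;> simp [nM] at hij ⊢
        · change nM i i = 1
          fin_cases i <;> simp [nM]
      · -- `n` fixes `N₁`
        apply Subtype.ext
        change mapGL nG (A (-1)).1 = (A (-1)).1
        rw [hAm1]
        ext x'
        rw [mem_mapGL_iff]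
        change nMi.mulVec x' ∈ latt (Matrix.diagonal ![(1 : K), 1, ϖ]) ↔ _
        obtain ⟨e0, e1, e2⟩ := hact x'
        rw [hN₁, hN₁, e0, e1, e2]
        constructor
        · rintro ⟨h0, h1, h2⟩
          have hx1 : Valued.v (x' 1) ≤ 1 := hrec1 x' h1 h2
          exact ⟨hrec0 x' h0 hx1 h2, hx1, h2⟩
        · rintro ⟨h0, h1, h2⟩
          exact ⟨hfwd0 x' h0 h1 h2, v_sub_le_one_of_le h1 (hγq _ h2), h2⟩
      · -- `n · 𝒪³ = N₁ + 𝒪 w(a,b)`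
        apply Subtype.ext
        change mapGL nG (A 0).1 = y.1
        rw [hA0', hyab]
        apply le_antisymm
        · intro x' hx'
          rw [mem_mapGL_iff] at hx'
          change nMi.mulVec x' ∈ stdLattice K 3 at hx'
          have hi : ∀ i, Valued.v (nMi.mulVec x' i) ≤ 1 := hx'
          obtain ⟨e0, e1, e2⟩ := hact x'
          have h0 := hi 0; have h1 := hi 1; have h2 := hi 2
          rw [e0] at h0; rw [e1] at h1; rw [e2] at h2
          refine mem_sup_span_singleton_of_sub_smul_mem (x' 2 / b) (by rw [map_div₀, hvb1, div_one]; exact h2) ((hN₁ _).2 ⟨?_, ?_, ?_⟩)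
          · simp only [Pi.sub_apply, Pi.smul_apply, smul_eq_mul, Matrix.cons_val_zero]
            have e : x' 0 - x' 2 / b * (a / ϖ) = (x' 0 - m * x' 1 + (m * γ - β) * x' 2) + m * (x' 1 - γ * x' 2) + l * x' 2 := by
              rw [← hβc, hβ, hc]; field_simp; ring
            rw [e]
            exact v_add_le_one_of_le (v_add_le_one_of_le h0 (v_mul_le_one_of_le hm h1)) (v_mul_le_one_of_le hl h2)
          · simp only [Pi.sub_apply, Pi.smul_apply, smul_eq_mul, Matrix.cons_val_one, Matrix.cons_val_zero, mul_zero, sub_zero]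
            rw [show x' 1 = (x' 1 - γ * x' 2) + γ * x' 2 by ring]
            exact v_add_le_one_of_le h1 (v_mul_le_one_of_le hvγ h2)
          · simp only [Pi.sub_apply, Pi.smul_apply, smul_eq_mul, Matrix.cons_val_two, Matrix.tail_cons, Matrix.head_cons]
            rw [div_mul_cancel₀ _ hb0, sub_self, map_zero]; exact zero_le
        · refine sup_le (fun x' hx' => ?_) (span_singleton_le_of_mem ?_)
          · obtain ⟨h0, h1, h2⟩ := (hN₁ x').1 hx'
            rw [mem_mapGL_iff]
            change nMi.mulVec x' ∈ stdLattice K 3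
            obtain ⟨e0, e1, e2⟩ := hact x'
            intro i; fin_cases i
            · change Valued.v (nMi.mulVec x' 0) ≤ 1; rw [e0]; exact hfwd0 x' h0 h1 h2
            · change Valued.v (nMi.mulVec x' 1) ≤ 1; rw [e1]; exact v_sub_le_one_of_le h1 (hγq _ h2)
            · change Valued.v (nMi.mulVec x' 2) ≤ 1; rw [e2]; exact h2.trans hϖ1
          · rw [mem_mapGL_iff]
            change nMi.mulVec ![a / ϖ, 0, b] ∈ stdLattice K 3
            obtain ⟨e0, e1, e2⟩ := hact ![a / ϖ, 0, b]
            intro i; fin_cases i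
            · change Valued.v (nMi.mulVec ![a / ϖ, 0, b] 0) ≤ 1
              rw [e0]
              simp only [Matrix.cons_val_zero, Matrix.cons_val_one, Matrix.cons_val_two, Matrix.tail_cons, Matrix.head_cons, mul_zero, sub_zero]
              have e : a / ϖ + (m * γ - β) * b = m * γ * b - l * b := by
                rw [← hβc, hβ, hc]; field_simp; ring
              rw [e]
              exact v_sub_le_one_of_le (v_mul_le_one_of_le (v_mul_le_one_of_le hm hvγ) hb) (v_mul_le_one_of_le hl hb)
            · change Valued.v (nMi.mulVec ![a / ϖ, 0, b] 1) ≤ 1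
              rw [e1]
              simp only [Matrix.cons_val_one, Matrix.cons_val_zero, Matrix.cons_val_two, Matrix.tail_cons, Matrix.head_cons, zero_sub, Valuation.map_neg]
              exact v_mul_le_one_of_le hvγ hb
            · change Valued.v (nMi.mulVec ![a / ϖ, 0, b] 2) ≤ 1; rw [e2]; simpa using hb

end Literature.NumberTheory.Automorphic.UnitaryLatticeTree

/-! ## §2 The datum token's shape (`IsRamifiedQuadraticDatum` lives at `K : Type`) -/

namespace Literature.NumberTheory.Automorphic.UnitaryLatticeTree

open _root_.SimpleGraph Literature.NumberTheory.Automorphic Literature.NumberTheory.Automorphic.HermitianLattice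
open Literature.NumberTheory.Automorphic.UnitaryGroup
open Literature.NumberTheory.Automorphic.UnitaryThreeFourFrame

variable {K : Type} [Field K] [Valued K ℤᵐ⁰] {σ : K →+* K} {ϖ : K}

/-- **(H3) IN THE DATUM TOKEN'S SHAPE** (`hD : IsRamifiedQuadraticDatum σ ϖ d t`, the currency of Track A's unit U0 `F0_P3c_DyRamFourFrame_U0_WildTree`): the type-two-star
horocycle step at every ramified quadratic datum with finite residue field — the odd-`j`, `N₁` case of the `hH4` binder of ★ (S) `eq_apartmentEnum_sub_one_or_exists_mem_unipotentU_of_adj_of_involution`,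
★ (H5)–(H8) `…HorosphereTransversalOfInvolution` and ★ `exists_vertexOrbitData_of_involution` ∕ `exists_edgeOrbitData_of_involution`.  Conclusion VERBATIM = ★ (H3)'s.
[cite: BruhatTits1972, (4.4.4) and §10] [cite: Tits1979, §2.7 (p. 48)] [cite: Serre1980Trees, II.1.1] -/
theorem exists_mem_unipotentU_apply_apartmentEnum_zero_eq_of_adj_neg_one_of_isRamifiedQuadraticDatum [Finite 𝓀[K]] {d t : ℕ} (hD : IsRamifiedQuadraticDatum σ ϖ d t)
    (A : ℤ → {M : Submodule 𝒪[K] (Fin 3 → K) // IsVertex σ ϖ ((StdForm.antidiagonal 3).over K) M})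
    (hA0 : ∀ a : ℤ, (A (2 * a)).1 = latt (Matrix.diagonal ![ϖ ^ a, (1 : K), ϖ ^ (-a)]))
    (hA1 : ∀ a : ℤ, (A (2 * a + 1)).1 = latt (Matrix.diagonal ![ϖ ^ (a + 1), (1 : K), ϖ ^ (-a)]))
    {y : {M : Submodule 𝒪[K] (Fin 3 → K) // IsVertex σ ϖ ((StdForm.antidiagonal 3).over K) M}}
    (hy : (latticeGraph σ ϖ ((StdForm.antidiagonal 3).over K)).Adj (A (-1)) y) (hy' : y ≠ A (-2)) :
    ∃ n : unitaryGroupOfForm σ ((StdForm.antidiagonal 3).over K), n ∈ unipotentU σ ((StdForm.antidiagonal 3).over K) ∧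
      latticeGraphIso σ ϖ ((StdForm.antidiagonal 3).over K) n (A (-1)) = A (-1) ∧ latticeGraphIso σ ϖ ((StdForm.antidiagonal 3).over K) n (A 0) = y :=
  exists_mem_unipotentU_apply_apartmentEnum_zero_eq_of_adj_neg_one_of_ramified hD.1 hD.2.1 hD.2.2.1 hD.2.2.2.1 hD.2.2.2.2.1 hD.2.2.2.2.2.1 hD.2.2.2.2.2.2 A hA0 hA1 hy hy'

end Literature.NumberTheory.Automorphic.UnitaryLatticeTree

end
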